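import Summits.BirchSwinnertonDyer.BirchSwinnertonDyer.Theorems.ManinLocalTwoThreeKummerDiamondStepTwoToolkit
import Summits.BirchSwinnertonDyer.BirchSwinnertonDyer.Theorems.ManinLocalTwoThreeFreyTwistParityNormalForms
import Summits.BirchSwinnertonDyer.Rank1Residual.ManinAdditive.KummerDiamondShapeLaws
import HarnessLib

/-!
# Toolkit for es's STEP 2 (D6 of LEAD's `kummer_diamond` line), II: the prime `2` (Hensel, the lone-`2` exclusion, the LEMMA-M conductor) and
# the odd law `ϖ_{p^b} = v·(·/p)`
(route `ManinLocalTwoThree`, crux C2 `ManinOddAtFour` stmt-BirchSwinnertonDyer-22967; cell bsd-f2-manin, prover p2 gen 21; nodes for the Lean proof of E-es-185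
`IndexFourForcesFreyTwistShape`, es g38 PROOF-Ees185-186.md §4 PROPOSITION A / MEMO-es §59.5 STEP 2; `--supports stmt-BirchSwinnertonDyer-22967`)

Same abstract currency as part I (`w : Γ₀(N) → V` additive, `d_γ` read in `ZMod`):
* §5 `exists_odd_sq_sub_dvd_two_pow` (Hensel: `d ≡ 1 (mod 8)` is an odd square mod `2^a`), `exists_gamma0_sq_cast_eq`, `w_eq_zero_of_cast_eight_mul_eq_one` /
  `w_eq_of_cast_eight_eq` (an exponent-`2` `w` trivial on `d_γ ≡ 1 (mod N)` sees only `d_γ mod 8` on `d_γ ≡ 1 (mod y)`, `N = 2^a·y`, `a ≥ 3`),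
  **`exists_forall_eq_zero_or_eq_of_lone_two`** (es: «`S′ = {2^a}` is impossible: `ϖ` would factor through `(ℤ/2^k)ˣ/±1`» — if the odd part of the
  diamond character vanishes and `ϖ(−1) = 0`, `w` takes at most one non-zero value);
* §6 `ceilSqrtLevel_dvd`, `ceilSqrtLevel_mul_of_coprime`, `ceilSqrtLevel_two_pow`, `w_eq_zero_of_cast_ceil_eq_one` (LEMMA M E-es-184 ⟹ at `2` the character has
  conductor `2^{⌈a/2⌉}`);
* §7 **`w_eq_zero_iff_isSquare`** (es: «`im ϖ_{p^b} = {0,v}`, so `ϖ_{p^b} = v·(·/p)`»: a non-trivial exponent-`2` `ϖ_{p^b}` vanishes exactly on the squares mod `p`).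
UNCONDITIONAL group theory / elementary number theory; nothing about C2, Manin's conjecture or BSD is proved.  No definitions, no sorry. [folklore]
[cite: Stevens1989, §2] [cite: Manin1972, Prop. 1.4 / Thm. 1.6]
-/

set_option autoImplicit false
-- lint-debt: the directory name repeats the summit name (sibling precedent `ManinLocalTwoThreeKummerDiamondStepTwoToolkit.lean`)
set_option linter.dupNamespace false

open scoped MatrixGroups
open CongruenceSubgroup

namespace Summit.BirchSwinnertonDyer.BirchSwinnertonDyer.Theorems.ManinLocalTwoThree.StepTwo

variable {N : ℕ}

/-! ## §5 Hensel at `2`: `d ≡ 1 (mod 8)` is an odd square modulo every `2^a` -/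

/-- **Hensel at `2`.**  An integer `≡ 1 (mod 8)` is congruent to an odd square modulo every power of `2`. [folklore] -/
theorem exists_odd_sq_sub_dvd_two_pow (a : ℕ) {d : ℤ} (hd : (8 : ℤ) ∣ d - 1) : ∃ x : ℤ, Odd x ∧ (2 : ℤ) ^ a ∣ x ^ 2 - d := by
  induction a with
  | zero => exact ⟨1, odd_one, by rw [pow_zero]; exact one_dvd _⟩
  | succ n ih =>
    by_cases hn : n + 1 ≤ 3
    · refine ⟨1, odd_one, ?_⟩
      have h8 : (2 : ℤ) ^ (n + 1) ∣ 8 := by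
        rw [show (8 : ℤ) = 2 ^ 3 by norm_num]; exact pow_dvd_pow 2 hn
      exact dvd_trans h8 (by rw [show (1 : ℤ) ^ 2 - d = -(d - 1) by ring]; exact (dvd_neg).mpr hd)
    · obtain ⟨m, rfl⟩ : ∃ m, n = m + 3 := ⟨n - 3, by omega⟩
      obtain ⟨x, hx, t, ht⟩ := ih
      rcases Int.even_or_odd t with ⟨s, hs⟩ | hto
      · refine ⟨x, hx, s, ?_⟩
        rw [ht, hs]; ring
      · obtain ⟨r, hr⟩ := Odd.add_odd hto hx
        refine ⟨x + 2 ^ (m + 2), ?_, r + 2 ^ m, ?_⟩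
        · exact hx.add_even ((even_two).pow_of_ne_zero (by omega))
        · linear_combination ht + (2 : ℤ) ^ (m + 3) * hr

/-- An integer coprime to an even number is odd. [folklore] -/
theorem not_two_dvd_of_isCoprime {d n : ℤ} (h : IsCoprime d n) (hn : 2 ∣ n) : ¬ 2 ∣ d := by
  rintro hd
  obtain ⟨u, v, huv⟩ := h
  have : (2 : ℤ) ∣ 1 := by rw [← huv]; exact dvd_add (dvd_mul_of_dvd_right hd u) (dvd_mul_of_dvd_right hn v)
  omega

/-- `d_γ mod 8` is determined by an odd SQUARE ROOT: for `N = 2^a·y`, `gcd(2^a, y) = 1` and `δ ∈ Γ₀(N)` with `d_δ ≡ 1 (mod 8)` there is `γ ∈ Γ₀(N)` with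
`d_{γ²} ≡ d_δ (mod 2^a)` and `d_γ ≡ 1 (mod y)`. [folklore] -/
theorem exists_gamma0_sq_cast_eq {a y : ℕ} (hQy : 2 ^ a * y = N) (hcop : Nat.Coprime (2 ^ a) y) (δ : Gamma0 N)
    (hδ : ((((δ : SL(2, ℤ)) 1 1 : ℤ)) : ZMod 8) = 1) :
    ∃ γ : Gamma0 N, ((((γ ^ 2 : Gamma0 N) : SL(2, ℤ)) 1 1 : ℤ) : ZMod (2 ^ a)) = ((((δ : SL(2, ℤ)) 1 1 : ℤ)) : ZMod (2 ^ a)) ∧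
      ((((γ : SL(2, ℤ)) 1 1 : ℤ)) : ZMod y) = 1 := by
  set d : ℤ := ((δ : SL(2, ℤ)) 1 1 : ℤ) with hd
  have h8 : (8 : ℤ) ∣ d - 1 := by
    have h := (ZMod.intCast_eq_intCast_iff_dvd_sub 1 d 8).mp (by rw [hδ]; push_cast; rfl)
    exact_mod_cast h
  obtain ⟨x, hx, hxd⟩ := exists_odd_sq_sub_dvd_two_pow a h8
  obtain ⟨e, he2, hey⟩ := exists_int_cast_eq_cast_eq hcop x 1
  have hey' : (e : ZMod y) = 1 := by rw [hey]; push_cast; rfl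
  -- `e` is coprime to `N = 2^a·y`: odd and `≡ 1 (mod y)`
  have hcop2 : IsCoprime e ((2 : ℤ) ^ a) := by
    rcases Nat.eq_zero_or_pos a with rfl | ha
    · rw [pow_zero]; exact isCoprime_one_right
    · have h2e : ¬ 2 ∣ e := by
        intro h2
        have hx2 : (2 : ℤ) ∣ x := by
          have hdiff : ((2 ^ a : ℕ) : ℤ) ∣ x - e := (ZMod.intCast_eq_intCast_iff_dvd_sub e x (2 ^ a)).mp he2
          have h2a : (2 : ℤ) ∣ ((2 ^ a : ℕ) : ℤ) := by push_cast; exact dvd_pow_self 2 ha.ne'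
          have := dvd_add (dvd_trans h2a hdiff) h2
          rwa [sub_add_cancel] at this
        exact (Int.not_even_iff_odd.mpr hx) (even_iff_two_dvd.mpr hx2)
      obtain ⟨k, hk⟩ := Int.not_even_iff_odd.mp (fun he ↦ h2e (even_iff_two_dvd.mp he))
      exact IsCoprime.pow_right ⟨1, -k, by rw [hk]; ring⟩
  have hcopy : IsCoprime e (y : ℤ) := by
    obtain ⟨t, ht⟩ := (ZMod.intCast_eq_intCast_iff_dvd_sub 1 e y).mp (by rw [hey']; push_cast; rfl)
    exact ⟨1, -t, by linear_combination ht⟩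
  have hcopN : IsCoprime e (N : ℤ) := by
    rw [← hQy]; push_cast; exact IsCoprime.mul_right hcop2 hcopy
  obtain ⟨γ, hγ⟩ := SmallImageLemmaPrimeReduction.exists_gamma0_apply_one_one_eq hcopN
  refine ⟨γ, ?_, by rw [hγ, hey']⟩
  have h2N : 2 ^ a ∣ N := ⟨y, hQy.symm⟩
  rw [pow_two, lowerRight_mul_cast _ _ h2N, hγ, he2, ← pow_two]
  have h := (ZMod.intCast_eq_intCast_iff_dvd_sub d (x ^ 2) (2 ^ a)).mpr (by exact_mod_cast hxd)
  push_cast at h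
  exact h.symm

section TwoAdic

variable {V : Type*} [AddCommGroup V] (w : Gamma0 N → V)

/-- **Squares are killed: on `d_γ ≡ 1 (mod y)` an exponent-`2` `w` trivial on `d_γ ≡ 1 (mod N)` is trivial on `d_γ ≡ 1 (mod 8y)`** (`N = 2^a·y`).
[folklore] -/
theorem w_eq_zero_of_cast_eight_mul_eq_one (hmul : ∀ γ γ' : Gamma0 N, w (γ * γ') = w γ + w γ')
    (hone : ∀ γ : Gamma0 N, ((((γ : SL(2, ℤ)) 1 1 : ℤ)) : ZMod N) = 1 → w γ = 0) (h2 : ∀ γ : Gamma0 N, w γ + w γ = 0)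
    {a y : ℕ} (hQy : 2 ^ a * y = N) (hcop : Nat.Coprime (2 ^ a) y) (δ : Gamma0 N)
    (hδ : ((((δ : SL(2, ℤ)) 1 1 : ℤ)) : ZMod (8 * y)) = 1) : w δ = 0 := by
  subst hQy
  have hδ8 : ((((δ : SL(2, ℤ)) 1 1 : ℤ)) : ZMod 8) = 1 := by
    have h := congrArg (ZMod.castHom (dvd_mul_right 8 y) (ZMod 8)) hδ
    rwa [map_intCast, map_one] at h
  have hδy : ((((δ : SL(2, ℤ)) 1 1 : ℤ)) : ZMod y) = 1 := by
    have h := congrArg (ZMod.castHom (dvd_mul_left y 8) (ZMod y)) hδ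
    rwa [map_intCast, map_one] at h
  obtain ⟨γ, hγ2, hγy⟩ := exists_gamma0_sq_cast_eq rfl hcop δ hδ8
  have hyN : y ∣ 2 ^ a * y := dvd_mul_left y _
  have hN' : ((((γ ^ 2 : Gamma0 (2 ^ a * y)) : SL(2, ℤ)) 1 1 : ℤ) : ZMod (2 ^ a * y)) =
      ((((δ : SL(2, ℤ)) 1 1 : ℤ)) : ZMod (2 ^ a * y)) := by
    rw [intCast_zmod_mul_eq_iff_of_coprime hcop]
    refine ⟨hγ2, ?_⟩
    rw [hδy, pow_two, lowerRight_mul_cast _ _ hyN, hγy, one_mul]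
  rw [← w_eq_of_cast_eq w hmul dvd_rfl hone hN', pow_two, hmul]
  exact h2 γ

/-- **`w` sees only `d_γ mod 8` on `d_γ ≡ 1 (mod y)`** (`N = 2^a·y`, `a ≥ 3`, `w` additive of exponent `2`, trivial on `d_γ ≡ 1 (mod N)`). [folklore] -/
theorem w_eq_of_cast_eight_eq (hmul : ∀ γ γ' : Gamma0 N, w (γ * γ') = w γ + w γ')
    (hone : ∀ γ : Gamma0 N, ((((γ : SL(2, ℤ)) 1 1 : ℤ)) : ZMod N) = 1 → w γ = 0) (h2 : ∀ γ : Gamma0 N, w γ + w γ = 0)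
    {a y : ℕ} (ha : 3 ≤ a) (hQy : 2 ^ a * y = N) (hcop : Nat.Coprime (2 ^ a) y) {γ γ' : Gamma0 N}
    (hγ : ((((γ : SL(2, ℤ)) 1 1 : ℤ)) : ZMod y) = 1) (hγ' : ((((γ' : SL(2, ℤ)) 1 1 : ℤ)) : ZMod y) = 1)
    (h8 : ((((γ : SL(2, ℤ)) 1 1 : ℤ)) : ZMod 8) = ((((γ' : SL(2, ℤ)) 1 1 : ℤ)) : ZMod 8)) : w γ = w γ' := by
  have h8N : 8 * y ∣ N := by
    rw [← hQy]; exact mul_dvd_mul_right (by rw [show 8 = 2 ^ 3 by norm_num]; exact pow_dvd_pow 2 ha) y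
  have hcop8 : Nat.Coprime 8 y :=
    Nat.Coprime.coprime_dvd_left (by rw [show 8 = 2 ^ 3 by norm_num]; exact pow_dvd_pow 2 ha) hcop
  refine w_eq_of_cast_eq w hmul h8N (fun δ hδ ↦ w_eq_zero_of_cast_eight_mul_eq_one w hmul hone h2 hQy hcop δ hδ) ?_
  rw [intCast_zmod_mul_eq_iff_of_coprime hcop8]
  exact ⟨h8, by rw [hγ, hγ']⟩

/-- **The lone `2`-power exclusion** (es: «`S′ = {2^a}`: `ϖ` factors through `(ℤ/2^k)ˣ/±1`, whose square-class quotient is cyclic»).  If `N = 2^a·y`,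
`gcd(2^a, y) = 1`, and the additive exponent-`2` function `w` is trivial on `d_γ ≡ 1 (mod 2^a)` (the odd part of the diamond character vanishes)
and on `d_γ ≡ −1 (mod N)` (`ϖ(−1) = 0`), then `w` takes at most ONE non-zero value. [folklore] -/
theorem exists_forall_eq_zero_or_eq_of_lone_two [NeZero N] (hmul : ∀ γ γ' : Gamma0 N, w (γ * γ') = w γ + w γ')
    (h2 : ∀ γ : Gamma0 N, w γ + w γ = 0) {a y : ℕ} (hQy : 2 ^ a * y = N) (hcop : Nat.Coprime (2 ^ a) y)
    (hkill : ∀ γ : Gamma0 N, ((((γ : SL(2, ℤ)) 1 1 : ℤ)) : ZMod (2 ^ a)) = 1 → w γ = 0)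
    (hneg : ∀ γ : Gamma0 N, ((((γ : SL(2, ℤ)) 1 1 : ℤ)) : ZMod N) = -1 → w γ = 0) :
    ∃ v : V, ∀ γ : Gamma0 N, w γ = 0 ∨ w γ = v := by
  have h2N : 2 ^ a ∣ N := ⟨y, hQy.symm⟩
  -- `w` factors through `d mod 2^a`
  have W₁ := fun (γ γ' : Gamma0 N) ↦ w_eq_of_cast_eq w hmul h2N hkill (γ := γ) (γ' := γ')
  obtain ⟨γm, hγm⟩ := exists_gamma0_lowerRight_eq_neg_one (N := N)
  have hwm : w γm = 0 := hneg γm (by rw [hγm]; push_cast; rfl)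
  -- every `d_γ` is odd once `a ≥ 1`
  have hodd : 1 ≤ a → ∀ γ : Gamma0 N, ¬ 2 ∣ ((γ : SL(2, ℤ)) 1 1 : ℤ) := fun ha γ ↦
    not_two_dvd_of_isCoprime (isCoprime_lowerRight γ) (by
      rw [← hQy]; push_cast; exact dvd_mul_of_dvd_left (dvd_pow_self 2 (by omega)) _)
  by_cases ha : a ≤ 2
  · -- `(ℤ/2^a)ˣ ⊆ {±1}`: everything is killed
    refine ⟨0, fun γ ↦ Or.inl ?_⟩
    interval_cases a
    · exact hkill γ (Subsingleton.elim (α := ZMod 1) _ _)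
    · apply hkill γ
      obtain ⟨k, hk⟩ := Int.not_even_iff_odd.mp (fun he ↦ hodd le_rfl γ (even_iff_two_dvd.mp he))
      rw [hk]; push_cast
      rw [show (2 : ZMod (2 ^ 1)) = 0 from rfl, zero_mul, zero_add]
    · obtain ⟨k, hk⟩ := Int.not_even_iff_odd.mp (fun he ↦ hodd (by norm_num) γ (even_iff_two_dvd.mp he))
      have h4 : ((((γ : SL(2, ℤ)) 1 1 : ℤ)) : ZMod (2 ^ 2)) = 1 ∨ ((((γ : SL(2, ℤ)) 1 1 : ℤ)) : ZMod (2 ^ 2)) = -1 := by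
        rw [hk]; push_cast
        generalize (k : ZMod (2 ^ 2)) = K
        revert K; decide
      rcases h4 with h | h
      · exact hkill γ h
      · rw [W₁ γ γm (by rw [h, hγm]; push_cast; rfl)]; exact hwm
  · -- `a ≥ 3`: `w` kills `d ≡ 1 (mod 8)` (Hensel), hence factors through `d mod 8 ∈ {1, 3, 5, 7}`
    rw [not_le] at ha
    have h8N : 8 ∣ N := dvd_trans (by rw [show 8 = 2 ^ 3 by norm_num]; exact pow_dvd_pow 2 ha) h2N
    have hkill8 : ∀ δ : Gamma0 N, ((((δ : SL(2, ℤ)) 1 1 : ℤ)) : ZMod 8) = 1 → w δ = 0 := by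
      intro δ hδ
      obtain ⟨γ, hγ2, -⟩ := exists_gamma0_sq_cast_eq hQy hcop δ hδ
      rw [← W₁ (γ ^ 2) δ hγ2, pow_two, hmul]; exact h2 γ
    have W₈ := fun (γ γ' : Gamma0 N) ↦ w_eq_of_cast_eq w hmul h8N hkill8 (γ := γ) (γ' := γ')
    -- a representative with `d ≡ 5 (mod 8)`
    obtain ⟨e, he2, hey⟩ := exists_int_cast_eq_cast_eq hcop 5 1
    have hcopN : IsCoprime e (N : ℤ) := by
      rw [← hQy]; push_cast
      refine IsCoprime.mul_right (IsCoprime.pow_right ?_) ?_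
      · -- `e ≡ 5 (mod 2^a)` is odd
        have hdiff : ((2 ^ a : ℕ) : ℤ) ∣ 5 - e := (ZMod.intCast_eq_intCast_iff_dvd_sub e 5 (2 ^ a)).mp he2
        have h2a : (2 : ℤ) ∣ ((2 ^ a : ℕ) : ℤ) := by push_cast; exact dvd_pow_self 2 (by omega)
        obtain ⟨t, ht⟩ := dvd_trans h2a hdiff
        exact ⟨1, -(2 - t), by linear_combination -ht⟩
      · obtain ⟨t, ht⟩ := (ZMod.intCast_eq_intCast_iff_dvd_sub e 1 y).mp (by rw [hey])
        exact ⟨1, t, by linear_combination -ht⟩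
    obtain ⟨γ₅, hγ₅⟩ := SmallImageLemmaPrimeReduction.exists_gamma0_apply_one_one_eq hcopN
    have h82a : 8 ∣ 2 ^ a := by rw [show 8 = 2 ^ 3 by norm_num]; exact pow_dvd_pow 2 ha
    have hγ₅8 : ((((γ₅ : SL(2, ℤ)) 1 1 : ℤ)) : ZMod 8) = 5 := by
      have h := congrArg (ZMod.castHom h82a (ZMod 8)) he2
      rw [map_intCast, map_intCast] at h
      rw [hγ₅, h]; push_cast; rfl
    refine ⟨w γ₅, fun γ ↦ ?_⟩
    rcases FreyTwistParity.cast_zmod_eight_of_not_two_dvd (hodd (by omega) γ) with h | h | h | h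
    · left; rw [W₈ γ 1 (by rw [h]; simp), w_one_eq w hmul]
    · right
      rw [W₈ γ (γm * γ₅) (by rw [h, lowerRight_mul_cast _ _ h8N, hγm, hγ₅8]; push_cast; decide), hmul, hwm, zero_add]
    · right; rw [W₈ γ γ₅ (by rw [h, hγ₅8])]
    · left; rw [W₈ γ γm (by rw [h, hγm]; push_cast; decide), hwm]

end TwoAdic

/-! ## §6 The conductor `M = ceilSqrtLevel N` of LEMMA M at the prime `2` -/

open Summit.BirchSwinnertonDyer.Rank1Residual.ManinAdditive.KummerDiamond in
/-- `ceilSqrtLevel n ∣ n` (`⌈v/2⌉ ≤ v`). [folklore] -/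
theorem ceilSqrtLevel_dvd (n : ℕ) : ceilSqrtLevel n ∣ n := by
  rcases Nat.eq_zero_or_pos n with rfl | hn
  · exact dvd_zero _
  conv_rhs => rw [← Nat.prod_factorization_pow_eq_self hn.ne']
  rw [ceilSqrtLevel, Finsupp.prod, Finsupp.prod]
  exact Finset.prod_dvd_prod_of_dvd _ _ fun p _ ↦ pow_dvd_pow p (by omega)

open Summit.BirchSwinnertonDyer.Rank1Residual.ManinAdditive.KummerDiamond in
/-- `ceilSqrtLevel` is multiplicative on coprime arguments. [folklore] -/
theorem ceilSqrtLevel_mul_of_coprime {m n : ℕ} (h : Nat.Coprime m n) :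
    ceilSqrtLevel (m * n) = ceilSqrtLevel m * ceilSqrtLevel n := by
  rw [ceilSqrtLevel, ceilSqrtLevel, ceilSqrtLevel, Nat.factorization_mul_of_coprime h,
    Finsupp.prod_add_index_of_disjoint]
  rw [Nat.support_factorization, Nat.support_factorization]
  exact h.disjoint_primeFactors

open Summit.BirchSwinnertonDyer.Rank1Residual.ManinAdditive.KummerDiamond in
/-- `ceilSqrtLevel (2^a) = 2^{⌈a/2⌉}`. [folklore] -/
theorem ceilSqrtLevel_two_pow (a : ℕ) : ceilSqrtLevel (2 ^ a) = 2 ^ ((a + 1) / 2) := by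
  rw [ceilSqrtLevel, Nat.Prime.factorization_pow Nat.prime_two, Finsupp.prod_single_index]
  simp

open Summit.BirchSwinnertonDyer.Rank1Residual.ManinAdditive.KummerDiamond in
/-- For `N = 2^a·y`, `gcd(2^a, y) = 1`: `ceilSqrtLevel N ∣ 2^{⌈a/2⌉}·y`. [folklore] -/
theorem ceilSqrtLevel_dvd_two_pow_mul {a y : ℕ} (hcop : Nat.Coprime (2 ^ a) y) :
    ceilSqrtLevel (2 ^ a * y) ∣ 2 ^ ((a + 1) / 2) * y := by
  rw [ceilSqrtLevel_mul_of_coprime hcop, ceilSqrtLevel_two_pow]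
  exact mul_dvd_mul_left _ (ceilSqrtLevel_dvd y)

open Summit.BirchSwinnertonDyer.Rank1Residual.ManinAdditive.KummerDiamond in
/-- **LEMMA M at the prime `2`**: if `w` is trivial on `d_γ ≡ ±1 (mod ceilSqrtLevel N)` (E-es-184), then for `N = 2^a·y`, `gcd(2^a, y) = 1`, it is trivial on
`d_γ ≡ 1 (mod 2^{⌈a/2⌉}·y)` — the hypothesis `hker` of `exists_forall_eq_zero_or_eq_twoPow_le_two` with `c = ⌈a/2⌉`. [cite: Manin1972, Prop. 1.4 / Thm. 1.6] -/
theorem w_eq_zero_of_cast_ceil_eq_one {V : Type*} [AddCommGroup V] (w : Gamma0 N → V) {a y : ℕ} (hQy : 2 ^ a * y = N)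
    (hcop : Nat.Coprime (2 ^ a) y)
    (hM : ∀ γ : Gamma0 N, ((((γ : SL(2, ℤ)) 1 1 : ℤ)) : ZMod (ceilSqrtLevel N)) = 1 ∨
      ((((γ : SL(2, ℤ)) 1 1 : ℤ)) : ZMod (ceilSqrtLevel N)) = -1 → w γ = 0)
    (γ : Gamma0 N) (hγ : ((((γ : SL(2, ℤ)) 1 1 : ℤ)) : ZMod (2 ^ ((a + 1) / 2) * y)) = 1) : w γ = 0 := by
  refine hM γ (Or.inl ?_)
  have hdvd : ceilSqrtLevel N ∣ 2 ^ ((a + 1) / 2) * y := by rw [← hQy]; exact ceilSqrtLevel_dvd_two_pow_mul hcop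
  have h := congrArg (ZMod.castHom hdvd (ZMod (ceilSqrtLevel N))) hγ
  rwa [map_intCast, map_one] at h

/-! ## §7 The odd law: a non-trivial `ϖ_{p^b}` vanishes exactly on the squares mod `p` -/

section OddLaw

variable {V : Type*} [AddCommGroup V] (w : Gamma0 N → V)

/-- `k • v = 0 ↔ k` even, for `v ≠ 0` with `v + v = 0`. [folklore] -/
theorem zsmul_eq_zero_iff_even {v : V} (hv : v + v = 0) (hv0 : v ≠ 0) (k : ℤ) : k • v = 0 ↔ Even k := by
  have h2 : (2 : ℤ) • v = 0 := by rw [two_zsmul]; exact hv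
  constructor
  · intro h
    by_contra hodd
    obtain ⟨j, hj⟩ := Int.not_even_iff_odd.mp hodd
    apply hv0
    rwa [hj, add_zsmul, mul_comm, mul_zsmul, h2, zsmul_zero, zero_add, one_zsmul] at h
  · rintro ⟨j, rfl⟩
    rw [← two_mul, mul_comm, mul_zsmul, h2, zsmul_zero]

/-- **The odd law.**  `N = p^b·y` (`p` an odd prime, `b ≥ 1`, `gcd(p^b, y) = 1`), `w` additive of exponent `2`, trivial on `d_γ ≡ 1 (mod N)`, and NOT
identically zero on `d_γ ≡ 1 (mod y)`: then for `d_γ ≡ 1 (mod y)`, `w γ = 0 ↔ d_γ` is a square mod `p` — es's «`im ϖ_{p^b} = {0, v}`, so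
`ϖ_{p^b} = v·(·/p)`, the unique character of order `2`». [folklore] -/
theorem w_eq_zero_iff_isSquare [NeZero N] (hmul : ∀ γ γ' : Gamma0 N, w (γ * γ') = w γ + w γ')
    (hone : ∀ γ : Gamma0 N, ((((γ : SL(2, ℤ)) 1 1 : ℤ)) : ZMod N) = 1 → w γ = 0) (h2 : ∀ γ : Gamma0 N, w γ + w γ = 0)
    {p b y : ℕ} [Fact p.Prime] (hp2 : p ≠ 2) (hb : 1 ≤ b) (hQy : p ^ b * y = N) (hcop : Nat.Coprime (p ^ b) y)
    (hex : ∃ γ₁ : Gamma0 N, ((((γ₁ : SL(2, ℤ)) 1 1 : ℤ)) : ZMod y) = 1 ∧ w γ₁ ≠ 0)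
    (γ : Gamma0 N) (hγ : ((((γ : SL(2, ℤ)) 1 1 : ℤ)) : ZMod y) = 1) :
    w γ = 0 ↔ IsSquare ((((γ : SL(2, ℤ)) 1 1 : ℤ)) : ZMod p) := by
  have hp : p.Prime := Fact.out
  haveI : IsCyclic (ZMod (p ^ b))ˣ := ZMod.isCyclic_units_of_prime_pow p hp hp2 b
  have hpN : p ∣ N := dvd_trans (dvd_pow_self p (by omega)) ⟨y, hQy.symm⟩
  have hpQ : p ∣ p ^ b * y := by rw [hQy]; exact hpN
  obtain ⟨φ, hφ⟩ := exists_unitsHom_lowerRight (N := N) hpN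
  obtain ⟨γ₀, hγ₀y, hgen⟩ := exists_generator_of_isCyclic w hmul h2 (dvd_refl (p ^ b)) hQy hcop (by rw [hQy]; exact hone)
  -- `w γ₀ ≠ 0`
  have hv0 : w γ₀ ≠ 0 := by
    obtain ⟨γ₁, hγ₁y, hγ₁⟩ := hex
    obtain ⟨k₁, -, hk₁⟩ := hgen γ₁ hγ₁y
    intro h0; apply hγ₁; rw [hk₁, h0, zsmul_zero]
  -- the unit `ḡ = d_{γ₀} mod p` generates `(ℤ/p)ˣ`
  have hgenp : ∀ u : (ZMod p)ˣ, u ∈ Subgroup.zpowers (φ γ₀) := by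
    intro u
    haveI : NeZero (p ^ b) := ⟨pow_ne_zero b hp.ne_zero⟩
    obtain ⟨U, hU⟩ := ZMod.unitsMap_surjective (dvd_pow_self p (by omega) : p ∣ p ^ b) u
    obtain ⟨e, heQ, hey⟩ := exists_int_cast_eq_cast_eq hcop (((U : ZMod (p ^ b)).val : ℕ) : ℤ) 1
    have heQ' : (e : ZMod (p ^ b)) = (U : ZMod (p ^ b)) := by rw [heQ]; push_cast; exact ZMod.natCast_zmod_val _
    have hey' : (e : ZMod y) = 1 := by rw [hey]; push_cast; rfl
    have hcopr : IsCoprime e (N : ℤ) := by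
      rw [← hQy]
      refine isCoprime_of_cast_mul_eq_one rfl hcop (d := ((((U⁻¹ : (ZMod (p ^ b))ˣ) : ZMod (p ^ b)).val : ℕ) : ℤ)) ?_ hey'
      push_cast
      rw [heQ', ZMod.natCast_zmod_val, Units.mul_inv]
    obtain ⟨γe, hγe⟩ := SmallImageLemmaPrimeReduction.exists_gamma0_apply_one_one_eq hcopr
    obtain ⟨k, hk, -⟩ := hgen γe (by rw [hγe, hey'])
    refine Subgroup.mem_zpowers_iff.mpr ⟨k, ?_⟩
    rw [← map_zpow, ← hU]
    ext
    rw [hφ, ZMod.unitsMap_val, ← heQ', ZMod.cast_intCast (dvd_pow_self p (by omega) : p ∣ p ^ b), ← hγe]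
    have h := congrArg (ZMod.castHom hpQ (ZMod p)) hk
    rw [map_intCast, map_intCast] at h
    exact h.symm
  have hord : orderOf (φ γ₀) = p - 1 := by
    rw [orderOf_eq_card_of_forall_mem_zpowers hgenp, Nat.card_eq_fintype_card, ZMod.card_units p]
  have heven : Even (p - 1) := hp.even_sub_one hp2
  -- `γ` through `γ₀`
  obtain ⟨k, hk, hwk⟩ := hgen γ hγ
  have hkp : φ γ = φ γ₀ ^ k := by
    rw [← map_zpow]; ext; rw [hφ, hφ]
    have h := congrArg (ZMod.castHom hpQ (ZMod p)) hk
    rwa [map_intCast, map_intCast] at h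
  rw [hwk, zsmul_eq_zero_iff_even (h2 γ₀) hv0, ← hφ γ, hkp]
  constructor
  · rintro ⟨j, rfl⟩
    exact ⟨((φ γ₀ ^ j : (ZMod p)ˣ) : ZMod p), by rw [← Units.val_mul, ← zpow_add]⟩
  · rintro ⟨r, hr⟩
    have hr0 : r ≠ 0 := by
      intro h0; rw [h0, mul_zero] at hr; exact (φ γ₀ ^ k).ne_zero hr
    obtain ⟨j, hj⟩ := Subgroup.mem_zpowers_iff.mp (hgenp (Units.mk0 r hr0))
    have hjk : φ γ₀ ^ (j + j) = φ γ₀ ^ k := by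
      ext; rw [zpow_add, Units.val_mul, hj, hr]; rfl
    have hdvd : ((p - 1 : ℕ) : ℤ) ∣ k - (j + j) := by
      rw [← hord, orderOf_dvd_iff_zpow_eq_one, zpow_sub, hjk, mul_inv_cancel]
    obtain ⟨m, hm⟩ := heven
    obtain ⟨t, ht⟩ := hdvd
    exact ⟨j + m * t, by rw [hm] at ht; push_cast at ht; linear_combination ht⟩

end OddLaw

end Summit.BirchSwinnertonDyer.BirchSwinnertonDyer.Theorems.ManinLocalTwoThree.StepTwo
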